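import Literature.Probability.LatticeModels.WeightedCurrentsIdentities
import HarnessLib

/-!
# Random currents with edge-dependent couplings: conditioning on the cluster of a vertex

Topic `Literature/Probability/LatticeModels`. The "conditioning on the cluster" step of Aizenman's
argument (Aizenman 1982) for edge-weighted currents `K ≥ 0` on a finite simple graph `G`
(`WeightedCurrents.lean`): once the cluster `C_{n₁+n₂}(x) = S` of the first source is frozen, the second
current splits into an inner part (inside `S`, no sources) and an outer part supported on the edges off
`S` (`offGraph G S`) carrying its sources `{z,t}` (`z, t ∉ S`); trading the outer part against an
independent current supported off `S` (`Current.spliceOff`) is a weight-preserving bijection. In current-sum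
form (`cluster_decomposition`, `Z_{S^c}[A] = ecurrentSumIn (offGraph G S) K A`):

`(∑ 1{∂n₁={x,y}} 1{∂n₂={z,t}} w w 1{C_{n₁+n₂}(x) = S}) · Z_{S^c}[∅]
   = (∑ 1{∂n₁={x,y}} 1{∂n₂=∅} w w 1{C_{n₁+n₂}(x) = S}) · Z_{S^c}[{z,t}]`      (`z, t ∉ S`).

The combinatorial content is `Current.splice_transfer`: for `C_{n₁+n₂}(x) = S` and `k` supported off `S`,
the spliced currents `n₂' = spliceOff S n₂ k`, `k' = spliceOff S k n₂` satisfy `C_{n₁+n₂'}(x) = S`, `k'`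
is supported off `S`, `∂k' = ∂n₂ ∖ S` and `∂n₂' = (∂n₂ ∩ S) ∪ (∂k ∖ S)` (currents vanish on the edges
leaving a cluster, `Current.apply_eq_zero_of_cluster_eq`; clusters only see the edges meeting them,
`Current.cluster_eq_of_agree`).

## References

* M. Aizenman, *Geometric analysis of φ⁴ fields and Ising models*, Comm. Math. Phys. 86 (1982), §5
  (conditioning on clusters of the double current) [Aizenman1982] — the source of the argument; the
  formal statements below are ours.
* R. Panis, arXiv:2309.05797 (2023), §4.2 (the bound of [A] following Proposition 4.7)
  [Panis2023Triviality].
-/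

noncomputable section

open Finset Filter
open scoped symmDiff ENNReal

namespace Literature.Probability.LatticeModels

variable {V : Type*} [Fintype V] [DecidableEq V] {G : SimpleGraph V} [DecidableRel G.Adj]

namespace Current

/-! ### Clusters are determined by the edges meeting them -/

omit [Fintype V] [DecidableEq V] [DecidableRel G.Adj] in
/-- Walk transfer: if from every vertex satisfying `P` each `H₁`-edge is an `H₂`-edge leading again into
`P`, then `H₁`-reachability from a `P`-vertex implies `H₂`-reachability. [folklore] -/
theorem reachable_transfer {H₁ H₂ : SimpleGraph V} {P : V → Prop}
    (hP : ∀ u w, P u → H₁.Adj u w → H₂.Adj u w ∧ P w) {x v : V} (hx : P x) (h : H₁.Reachable x v) :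
    H₂.Reachable x v := by
  suffices key : ∀ (u v : V) (_ : H₁.Walk u v), P u → H₂.Reachable x u → H₂.Reachable x v by
    obtain ⟨p⟩ := h
    exact key x v p hx (SimpleGraph.Reachable.refl x)
  intro u v p
  induction p with
  | nil => exact fun _ hxu => hxu
  | @cons u w v huw p ih =>
    intro hu hxu
    obtain ⟨h2, hw⟩ := hP u w hu huw
    exact ih hw (hxu.trans h2.reachable)

omit [DecidableEq V] in
/-- An open edge from a cluster vertex leads into the cluster. [folklore] -/
theorem mem_cluster_of_adj {m : Current G} {x u w : V} (hu : u ∈ m.cluster x)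
    (h : (Percolation.openGraph m.traced).Adj u w) : w ∈ m.cluster x := by
  rw [mem_cluster_iff] at hu ⊢
  exact hu.trans h.reachable

omit [DecidableEq V] in
/-- **Currents vanish on the edges leaving a cluster**: if `C_m(x) = S`, `a ∈ S`, `b ∉ S`, then
`m_{ab} = 0`. [folklore] -/
theorem apply_eq_zero_of_cluster_eq {m : Current G} {x : V} {S : Finset V} (hS : m.cluster x = S)
    {e : G.edgeFinset} {a b : V} (he : (e : Sym2 V) = s(a, b)) (ha : a ∈ S) (hb : b ∉ S) : m e = 0 := by
  by_contra hne
  have hab : a ≠ b := fun h => hb (h ▸ ha)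
  have hadj : (Percolation.openGraph m.traced).Adj a b := by
    rw [Percolation.openGraph_adj]
    refine ⟨⟨he ▸ e.2, ?_⟩, hab⟩
    have : (⟨s(a, b), he ▸ e.2⟩ : G.edgeFinset) = e := Subtype.ext he.symm
    rw [this]
    exact Nat.pos_of_ne_zero hne
  exact hb (hS ▸ mem_cluster_of_adj (hS.symm ▸ ha) hadj)

omit [DecidableEq V] in
/-- **Locality of clusters**: if `m'` agrees with `m` on every edge meeting `S = C_m(x)`, then
`C_{m'}(x) = S`. [folklore] -/
theorem cluster_eq_of_agree {m m' : Current G} {x : V} {S : Finset V} (hS : m.cluster x = S)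
    (hagree : ∀ e : G.edgeFinset, ¬ EdgeOff S (e : Sym2 V) → m' e = m e) : m'.cluster x = S := by
  have hstep : ∀ u w, u ∈ S →
      ((Percolation.openGraph m.traced).Adj u w ↔ (Percolation.openGraph m'.traced).Adj u w) := by
    intro u w hu
    rw [Percolation.openGraph_adj, Percolation.openGraph_adj]
    have hno : ¬ EdgeOff S (s(u, w) : Sym2 V) := fun ho => (edgeOff_mk.1 ho).1 hu
    constructor
    · rintro ⟨⟨hG, hpos⟩, hne⟩
      refine ⟨⟨hG, ?_⟩, hne⟩
      rw [hagree ⟨s(u, w), hG⟩ hno]; exact hpos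
    · rintro ⟨⟨hG, hpos⟩, hne⟩
      refine ⟨⟨hG, ?_⟩, hne⟩
      rw [← hagree ⟨s(u, w), hG⟩ hno]; exact hpos
  have hin : ∀ u w, u ∈ S → (Percolation.openGraph m.traced).Adj u w → w ∈ S := by
    intro u w hu h
    rw [← hS] at hu ⊢
    exact mem_cluster_of_adj hu h
  have hxS : x ∈ S := hS ▸ mem_cluster_self m x
  ext v
  rw [mem_cluster_iff]
  constructor
  · intro hv
    have h := reachable_transfer (H₁ := Percolation.openGraph m'.traced)
      (H₂ := Percolation.openGraph m.traced) (P := (· ∈ S))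
      (fun u w hu h' => ⟨(hstep u w hu).2 h', hin u w hu ((hstep u w hu).2 h')⟩) hxS hv
    rw [← hS, mem_cluster_iff]; exact h
  · intro hv
    have h1 : (Percolation.openGraph m.traced).Reachable x v := by rw [← mem_cluster_iff, hS]; exact hv
    exact reachable_transfer (H₁ := Percolation.openGraph m.traced)
      (H₂ := Percolation.openGraph m'.traced) (P := (· ∈ S))
      (fun u w hu h' => ⟨(hstep u w hu).1 h', hin u w hu h'⟩) hxS h1

/-! ### Degrees and sources of spliced currents -/

/-- On an edge at a vertex of `S`, `spliceOff S a b` reads `a`. [folklore] -/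
theorem spliceOff_apply_of_mem {S : Finset V} (a b : Current G) {e : G.edgeFinset} {v : V}
    (hv : v ∈ (e : Sym2 V)) (hvS : v ∈ S) : spliceOff S a b e = a e :=
  spliceOff_apply_of_not_edgeOff a b fun ho => ho v hv hvS

/-- **The splice transfer.** Let `C_{n₁+n₂}(x) = S` and let `k` be supported off `S`. Then
`n₂' = spliceOff S n₂ k` (inner part of `n₂`, outer part of `k`) and `k' = spliceOff S k n₂` (outer part
of `n₂`) satisfy: `C_{n₁+n₂'}(x) = S`, `k'` is supported off `S`, `∂k' = ∂n₂ ∖ S`, and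
`∂n₂' = (∂n₂ ∩ S) ∪ (∂k ∖ S)`. [folklore] -/
theorem splice_transfer {n₁ n₂ k : Current G} {x : V} {S : Finset V} (hS : (n₁ + n₂).cluster x = S)
    (hk : IsSupp (offGraph G S) k) :
    (n₁ + spliceOff S n₂ k).cluster x = S ∧ IsSupp (offGraph G S) (spliceOff S k n₂) ∧
      (spliceOff S k n₂).sources = n₂.sources.filter (· ∉ S) ∧
      (spliceOff S n₂ k).sources = n₂.sources.filter (· ∈ S) ∪ k.sources.filter (· ∉ S) := by
  rw [isSupp_offGraph_iff] at hk
  -- cut edges carry no `n₂`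
  have hcut : ∀ (e : G.edgeFinset) (v w : V), (e : Sym2 V) = s(v, w) → v ∉ S → w ∈ S → n₂ e = 0 := by
    intro e v w he hv hw
    have h0 := apply_eq_zero_of_cluster_eq hS (he.trans Sym2.eq_swap) hw hv
    simp only [Pi.add_apply, Nat.add_eq_zero_iff] at h0
    exact h0.2
  refine ⟨?_, ?_, ?_, ?_⟩
  · -- clusters only see the edges meeting `S`
    refine cluster_eq_of_agree hS fun e he => ?_
    simp only [Pi.add_apply, spliceOff_apply_of_not_edgeOff _ _ he]
  · rw [isSupp_offGraph_iff]
    intro e he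
    rw [spliceOff_apply_of_not_edgeOff _ _ he]
    exact hk e he
  · -- `deg_{k'}(v) = 0` on `S`, `= deg_{n₂}(v)` off `S`
    ext v
    rw [mem_sources_iff, Finset.mem_filter, mem_sources_iff]
    by_cases hvS : v ∈ S
    · have hdeg : (spliceOff S k n₂).degree v = 0 := by
        refine Finset.sum_eq_zero fun e _ => ?_
        by_cases hv : v ∈ (e : Sym2 V)
        · rw [if_pos hv, spliceOff_apply_of_mem _ _ hv hvS]
          exact hk e fun ho => ho v hv hvS
        · rw [if_neg hv]
      rw [hdeg]
      simp [hvS]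
    · have hdeg : (spliceOff S k n₂).degree v = n₂.degree v := by
        refine Finset.sum_congr rfl fun e _ => ?_
        by_cases hv : v ∈ (e : Sym2 V)
        · rw [if_pos hv, if_pos hv]
          obtain ⟨w, hw⟩ := Sym2.mem_iff_exists.1 hv
          by_cases hwS : w ∈ S
          · rw [spliceOff_apply_of_mem _ _ (hw ▸ Sym2.mem_mk_right v w) hwS, hcut e v w hw hvS hwS]
            exact hk e fun ho => ho w (hw ▸ Sym2.mem_mk_right v w) hwS
          · exact spliceOff_apply_of_edgeOff _ _ (hw ▸ edgeOff_mk.2 ⟨hvS, hwS⟩)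
        · rw [if_neg hv, if_neg hv]
      rw [hdeg]
      simp [hvS]
  · -- `deg_{n₂'}(v) = deg_{n₂}(v)` on `S`, `= deg_k(v)` off `S`
    ext v
    rw [mem_sources_iff, Finset.mem_union, Finset.mem_filter, Finset.mem_filter, mem_sources_iff,
      mem_sources_iff]
    by_cases hvS : v ∈ S
    · have hdeg : (spliceOff S n₂ k).degree v = n₂.degree v := by
        refine Finset.sum_congr rfl fun e _ => ?_
        by_cases hv : v ∈ (e : Sym2 V)
        · rw [if_pos hv, if_pos hv, spliceOff_apply_of_mem _ _ hv hvS]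
        · rw [if_neg hv, if_neg hv]
      rw [hdeg]
      simp [hvS]
    · have hdeg : (spliceOff S n₂ k).degree v = k.degree v := by
        refine Finset.sum_congr rfl fun e _ => ?_
        by_cases hv : v ∈ (e : Sym2 V)
        · rw [if_pos hv, if_pos hv]
          obtain ⟨w, hw⟩ := Sym2.mem_iff_exists.1 hv
          by_cases hwS : w ∈ S
          · rw [spliceOff_apply_of_mem _ _ (hw ▸ Sym2.mem_mk_right v w) hwS, hcut e v w hw hvS hwS]
            exact (hk e fun ho => ho w (hw ▸ Sym2.mem_mk_right v w) hwS).symm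
          · exact spliceOff_apply_of_edgeOff _ _ (hw ▸ edgeOff_mk.2 ⟨hvS, hwS⟩)
        · rw [if_neg hv, if_neg hv]
      rw [hdeg]
      simp [hvS]

omit [Fintype V] in
/-- The elements of `{z} Δ {t}` are `z` or `t`. [folklore] -/
theorem eq_or_eq_of_mem_symmDiff_singleton {z t v : V} (h : v ∈ ({z} : Finset V) ∆ {t}) : v = z ∨ v = t := by
  rw [Finset.mem_symmDiff, Finset.mem_singleton, Finset.mem_singleton] at h
  tauto

/-! ### The cluster decomposition identity -/

/-- **Conditioning on the cluster of `x`** (the decoupling step of Aizenman's argument, [A] in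
Panis 2023, §4.2): for `K ≥ 0`, a vertex set `S` and `z, t ∉ S`,
`(∑ 1{∂n₁={x,y}} 1{∂n₂={z,t}} w w 1{C_{n₁+n₂}(x)=S}) · Z_{S^c}[∅]
   = (∑ 1{∂n₁={x,y}} 1{∂n₂=∅} w w 1{C_{n₁+n₂}(x)=S}) · Z_{S^c}[{z,t}]`,
`Z_{S^c}[A]` the current sum over currents supported off `S`. Proof: the involution
`((n₁,n₂),k) ↦ ((n₁, spliceOff S n₂ k), spliceOff S k n₂)` of `Ω³` preserves the product of the weights
and exchanges the two constraint sets (`splice_transfer`). [cite: Panis2023Triviality, §4.2] -/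
theorem cluster_decomposition {K : G.edgeFinset → ℝ} (hK : ∀ e, 0 ≤ K e) {S : Finset V} {x y z t : V}
    (hz : z ∉ S) (ht : t ∉ S) :
    (∑' p : Current G × Current G, epairWeight K ({x} ∆ {y}) ({z} ∆ {t}) p *
        (if (p.1 + p.2).cluster x = S then 1 else 0)) * ecurrentSumIn (offGraph G S) K ∅ =
      (∑' p : Current G × Current G, epairWeight K ({x} ∆ {y}) ∅ p *
        (if (p.1 + p.2).cluster x = S then 1 else 0)) * ecurrentSumIn (offGraph G S) K ({z} ∆ {t}) := by
  -- the source constraints of the outer parts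
  have hzt_in : (({z} : Finset V) ∆ {t}).filter (· ∈ S) = ∅ :=
    Finset.filter_false_of_mem fun v hv hvS => by
      rcases eq_or_eq_of_mem_symmDiff_singleton hv with rfl | rfl
      · exact hz hvS
      · exact ht hvS
  have hzt_out : (({z} : Finset V) ∆ {t}).filter (· ∉ S) = {z} ∆ {t} :=
    Finset.filter_true_of_mem fun v hv hvS => by
      rcases eq_or_eq_of_mem_symmDiff_singleton hv with rfl | rfl
      · exact hz hvS
      · exact ht hvS
  -- the two triple sums
  set FA : (Current G × Current G) × Current G → ℝ≥0∞ := fun q =>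
    epairWeight K ({x} ∆ {y}) ({z} ∆ {t}) q.1 * (if (q.1.1 + q.1.2).cluster x = S then 1 else 0) *
      (if IsSupp (offGraph G S) q.2 ∧ q.2.sources = ∅ then q.2.eweight K else 0) with hFA
  set FB : (Current G × Current G) × Current G → ℝ≥0∞ := fun q =>
    epairWeight K ({x} ∆ {y}) ∅ q.1 * (if (q.1.1 + q.1.2).cluster x = S then 1 else 0) *
      (if IsSupp (offGraph G S) q.2 ∧ q.2.sources = {z} ∆ {t} then q.2.eweight K else 0) with hFB
  have hL : (∑' p : Current G × Current G, epairWeight K ({x} ∆ {y}) ({z} ∆ {t}) p *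
      (if (p.1 + p.2).cluster x = S then 1 else 0)) * ecurrentSumIn (offGraph G S) K ∅ = ∑' q, FA q := by
    rw [ecurrentSumIn, tsum_mul_tsum_eq_tsum_prod]
  have hR : (∑' p : Current G × Current G, epairWeight K ({x} ∆ {y}) ∅ p *
      (if (p.1 + p.2).cluster x = S then 1 else 0)) * ecurrentSumIn (offGraph G S) K ({z} ∆ {t}) =
      ∑' q, FB q := by
    rw [ecurrentSumIn, tsum_mul_tsum_eq_tsum_prod]
  rw [hL, hR]
  -- the involution
  set f : (Current G × Current G) × Current G → (Current G × Current G) × Current G :=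
    fun q => ((q.1.1, spliceOff S q.1.2 q.2), spliceOff S q.2 q.1.2) with hf
  have hinv : Function.Involutive f := by
    rintro ⟨⟨n₁, n₂⟩, k⟩
    simp only [hf, spliceOff_spliceOff]
  rw [← (hinv.toPerm f).tsum_eq FB]
  refine tsum_congr fun q => ?_
  obtain ⟨⟨n₁, n₂⟩, k⟩ := q
  change FA ((n₁, n₂), k) = FB ((n₁, spliceOff S n₂ k), spliceOff S k n₂)
  simp only [hFA, hFB, epairWeight]
  by_cases hA : (n₁.sources = {x} ∆ {y} ∧ n₂.sources = {z} ∆ {t}) ∧ (n₁ + n₂).cluster x = S ∧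
      (IsSupp (offGraph G S) k ∧ k.sources = ∅)
  · obtain ⟨⟨h1, h2⟩, hC, hk, hk0⟩ := hA
    obtain ⟨hC', hk', hsk', hsn'⟩ := splice_transfer hC hk
    have hn2' : (spliceOff S n₂ k).sources = ∅ := by
      rw [hsn', h2, hk0, hzt_in, Finset.filter_empty, Finset.empty_union]
    have hk'' : (spliceOff S k n₂).sources = {z} ∆ {t} := by rw [hsk', h2, hzt_out]
    rw [if_pos ⟨h1, h2⟩, if_pos hC, if_pos ⟨hk, hk0⟩, if_pos ⟨h1, hn2'⟩, if_pos hC', if_pos ⟨hk', hk''⟩,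
      mul_one, mul_one, mul_assoc, mul_assoc, eweight_spliceOff_mul_eweight_spliceOff hK S n₂ k]
  · -- the image satisfies the `B`-constraints only if the point satisfies the `A`-constraints
    have hB : ¬ ((n₁.sources = {x} ∆ {y} ∧ (spliceOff S n₂ k).sources = ∅) ∧
        (n₁ + spliceOff S n₂ k).cluster x = S ∧
        (IsSupp (offGraph G S) (spliceOff S k n₂) ∧ (spliceOff S k n₂).sources = {z} ∆ {t})) := by
      rintro ⟨⟨h1, h2'⟩, hC', hk', hk''⟩
      obtain ⟨hC, hk, hsk, hsn⟩ := splice_transfer hC' hk'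
      rw [spliceOff_spliceOff] at hC hk hsk hsn
      refine hA ⟨⟨h1, ?_⟩, hC, hk, ?_⟩
      · rw [hsn, h2', hk'', hzt_out, Finset.filter_empty, Finset.empty_union]
      · rw [hsk, h2', Finset.filter_empty]
    -- both sides vanish
    have hA0 : (if n₁.sources = {x} ∆ {y} ∧ n₂.sources = {z} ∆ {t} then n₁.eweight K * n₂.eweight K else 0) *
        (if (n₁ + n₂).cluster x = S then (1 : ℝ≥0∞) else 0) *
        (if IsSupp (offGraph G S) k ∧ k.sources = ∅ then k.eweight K else 0) = 0 := by
      by_cases h12 : n₁.sources = {x} ∆ {y} ∧ n₂.sources = {z} ∆ {t}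
      · by_cases hC : (n₁ + n₂).cluster x = S
        · have hk : ¬ (IsSupp (offGraph G S) k ∧ k.sources = ∅) := fun hk => hA ⟨h12, hC, hk⟩
          rw [if_neg hk, mul_zero]
        · rw [if_neg hC, mul_zero, zero_mul]
      · rw [if_neg h12, zero_mul, zero_mul]
    have hB0 : (if n₁.sources = {x} ∆ {y} ∧ (spliceOff S n₂ k).sources = ∅ then
          n₁.eweight K * (spliceOff S n₂ k).eweight K else 0) *
        (if (n₁ + spliceOff S n₂ k).cluster x = S then (1 : ℝ≥0∞) else 0) *
        (if IsSupp (offGraph G S) (spliceOff S k n₂) ∧ (spliceOff S k n₂).sources = {z} ∆ {t} then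
          (spliceOff S k n₂).eweight K else 0) = 0 := by
      by_cases h12 : n₁.sources = {x} ∆ {y} ∧ (spliceOff S n₂ k).sources = ∅
      · by_cases hC : (n₁ + spliceOff S n₂ k).cluster x = S
        · have hk : ¬ (IsSupp (offGraph G S) (spliceOff S k n₂) ∧ (spliceOff S k n₂).sources = {z} ∆ {t}) :=
            fun hk => hB ⟨h12, hC, hk⟩
          rw [if_neg hk, mul_zero]
        · rw [if_neg hC, mul_zero, zero_mul]
      · rw [if_neg h12, zero_mul, zero_mul]
    rw [hA0, hB0]

end Current

end Literature.Probability.LatticeModels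

end
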